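import Summits.CriticalPhenomena.CardyFormulaZ2.Theses.CardyTensorRG
import Literature.Probability.RandomPlanarGeometry.CardyFunctionIncBeta

/-!
# The crux `PolyominoGaussianLaw` follows from Cardy's formula (with exponent `a = 2/3`)
# (stmt-CriticalPhenomena-14337, route `CardyTensorRG`, line `registered`)

Cross-route and summit-side position of the crux `CardyTensorRG.PolyominoGaussianLaw` (ONE exponent
`a ∈ (0,1)` such that every polyomino conformal rectangle with lattice marks has bond-`ℤ²` crossing
limit `I_a(cross-ratio)`, `I_a(η) = ∫₀^η (s(1-s))^{-a} ds / ∫₀¹ (s(1-s))^{-a} ds`):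

* `stub_ofCardyLatticePolygon` — Cardy's formula for polyomino conformal rectangles (verbatim the
  shared target `CardyLatticePolygon` of the sibling routes CardyPolygonWords / CardyGluingRDE,
  stmt-CriticalPhenomena-4781, spelled out) implies the crux with `a = 2/3`, because Cardy's function
  IS the normalised incomplete beta law of exponent `2/3` on `[0,1]`
  (`cardyFunction_eq_incBeta13_div_holds`: `cardyFunction η = incBeta13 η / incBeta13 1`,
  `incBeta13 u = ∫₀^u (s(1-s))^{-(2/3)} ds`) and cross-ratios of uniformizing data lie in `(0,1)`;
* `stub_ofCardyFormulaZ2` — the summit conjunct `CardyFormulaZ2` (Cardy's formula for EVERY conformal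
  rectangle on bond-`ℤ²`) implies the crux; contrapositively (`not_cardyFormulaZ2_of_not`) a
  refutation of the crux would refute Cardy's formula on `ℤ²` as typed.

So a proof of stmt-4781 closes this crux in one line, and the crux is irrefutable short of `¬ CardyFormulaZ2`.
-/

open Filter Topology Set

namespace Summit.CriticalPhenomena.CardyFormulaZ2.Cruxes.PolyominoGaussianLaw.Birth

/-- On `[0,1]` Cardy's function is the normalised incomplete beta law with exponent `a = 2/3`, in the
spelling of the crux (`(s(1-s))^(-a)` with `a = 2/3`). [cite: BealsWong2016, §10.7 Exercise 4] -/
theorem cardyFunction_eq_betaLaw_twoThirds {η : ℝ} (hη : η ∈ Set.Icc (0 : ℝ) 1) :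
    Literature.Probability.RandomPlanarGeometry.cardyFunction η =
      intervalIntegral (fun s : ℝ => (s * (1 - s)) ^ (-(2 / 3 : ℝ))) 0 η MeasureTheory.volume /
        intervalIntegral (fun s : ℝ => (s * (1 - s)) ^ (-(2 / 3 : ℝ))) 0 1 MeasureTheory.volume :=
  Literature.Probability.RandomPlanarGeometry.cardyFunction_eq_incBeta13_div_holds η hη

/-- **Cardy's formula for polyomino conformal rectangles implies the crux, with `a = 2/3`**
(hypothesis = the sibling target `CardyLatticePolygon`, stmt-CriticalPhenomena-4781, verbatim). [folklore] -/
theorem stub_ofCardyLatticePolygon :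
    (∀ R : Literature.Probability.RandomPlanarGeometry.ConformalRectangle,
      (∃ δ₀ : ℝ, 0 < δ₀ ∧ (∃ s : Finset (ℤ × ℤ), R.carrier = interior (⋃ p ∈ s, {z : ℂ |
        δ₀ * (p.1 : ℝ) ≤ z.re ∧ z.re ≤ δ₀ * ((p.1 : ℝ) + 1) ∧ δ₀ * (p.2 : ℝ) ≤ z.im ∧
        z.im ≤ δ₀ * ((p.2 : ℝ) + 1)})) ∧ ∀ i, ∃ m n : ℤ, R.pt i = (δ₀ : ℂ) * ((m : ℂ) + (n : ℂ) * Complex.I)) →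
      R.HasCrossingLimit (Literature.Probability.Percolation.bondDomainCrossingProb R)
        Literature.Probability.RandomPlanarGeometry.cardyFunction) →
    Summit.CriticalPhenomena.CardyFormulaZ2.Theses.CardyTensorRG.PolyominoGaussianLaw := by
  intro hC
  refine ⟨2 / 3, ⟨by norm_num, by norm_num⟩, ?_⟩
  intro R hR φ x hφ
  have hlim := hC R hR φ x hφ
  have hη : Literature.Probability.RandomPlanarGeometry.crossRatio x ∈ Set.Icc (0 : ℝ) 1 :=
    Set.Ioo_subset_Icc_self
      (Literature.Probability.RandomPlanarGeometry.ConformalRectangle.crossRatio_mem_Ioo_of_isUniformizing hφ)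
  rw [cardyFunction_eq_betaLaw_twoThirds hη] at hlim
  exact hlim

/-- **The summit conjunct implies the crux**: Cardy's formula on bond-`ℤ²` for every conformal
rectangle (`Literature.Probability.Percolation.CardyFormulaZ2`, the sub-problem `CardyFormulaZ2`)
gives `PolyominoGaussianLaw` with `a = 2/3`. [folklore] -/
theorem stub_ofCardyFormulaZ2 (hC : Literature.Probability.Percolation.CardyFormulaZ2) :
    Summit.CriticalPhenomena.CardyFormulaZ2.Theses.CardyTensorRG.PolyominoGaussianLaw :=
  stub_ofCardyLatticePolygon fun R _ => hC R

/-- Contrapositive: a refutation of the crux refutes Cardy's formula on bond-`ℤ²` as typed. [folklore] -/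
theorem not_cardyFormulaZ2_of_not
    (h : ¬ Summit.CriticalPhenomena.CardyFormulaZ2.Theses.CardyTensorRG.PolyominoGaussianLaw) :
    ¬ Literature.Probability.Percolation.CardyFormulaZ2 :=
  fun hC => h (stub_ofCardyFormulaZ2 hC)

end Summit.CriticalPhenomena.CardyFormulaZ2.Cruxes.PolyominoGaussianLaw.Birth
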